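import Summits.HubbardSuperconductivity.HubbardSuperconductivity.Theorems.SoloBlindFiniteVolumeCriterion
import Literature.MathematicalPhysics.QuantumLattice.FreeFermiGasNoPairFieldLRO
import Literature.MathematicalPhysics.QuantumLattice.SectorGroundProjContinuity
import HarnessLib

/-!
# The free-gas rung: the summit's conclusion FAILS at `U = 0`

`HubbardSuperconductivity` asserts that for SOME `U > 0` and some doping `δ ∈ (0, 1/2)` every
admissible sequence of sector ground states of `hubbardTorus 2 L 1 U` has `d_{x²-y²}` pair-field
long-range order. This file proves, sorry-free, that the same conclusion is FALSE at `U = 0`, for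
every `δ ∈ (0, 1/2)`:

* `exists_groundState_dWave_order_le_free` — at `U = 0`, `t = 1`, side `L ≥ 3`, in every joint
  sector `(N, S^z = M)` that has a ground state there is a UNIT GROUND STATE `ψ` with
  `re ⟨ψ, Δ_d†Δ_d ψ⟩ ≤ 32 L²` (an `L²` law, not `L⁴`). Proof: the Literature bound
  `re tr (P_E Δ_d†Δ_d) ≤ 32 L² · re tr P_E` for the projection `P_E` onto the sector ground
  eigenspace `E` (`re_trace_sectorEigenProj_mul_pairField_dWave_le_free`, Bloch occupation numbers
  commute with the free Hamiltonian), expanded over an orthonormal frame of `E`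
  (`exists_frame_trace_projMatrix_map_mul`): the minimum over the frame is at most the average.
* `not_dWaveLRO_groundStates_free` — hence the matrix of the summit with `U := 0` is false for
  every `δ ∈ (0, 1/2)`: selecting these ground states at every side gives an admissible sequence
  whose box-averaged correlation is `≤ 32/(2k)²`, so its `liminf` is `0`.

Reading (obstruction atlas, requirement "non-perturbative in `U`"): the target property
`S(U)` := "every admissible ground-state sequence at coupling `U` has `d`-wave LRO" satisfies
`¬ S(0)` (this file) while the summit claims `S(U)` for some `U > 0`; together with
`dWave_order_not_energy_robust` / `multiplier_mul_twistEnergy_ge` (the order is not stable under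
`O(1)` energy perturbations and any certificate lives in an `L`-independent energy window) this
pins down that a proof must extract an `L⁴` order from an interaction effect that is invisible at
`U = 0` in the very same sectors — no continuity-in-`U` or openness argument can start from the free
gas.

References: J. Bardeen, L. N. Cooper, J. R. Schrieffer, Phys. Rev. 108 (1957) 1175, §II (free Fermi
sea has no pair condensate); C. N. Yang, Rev. Mod. Phys. 34 (1962) 694, §3 (ODLRO bounds);
D. J. Scalapino, Phys. Rep. 250 (1995) 329, §2. The statements here are folklore consequences.
-/

noncomputable section

namespace Summit.HubbardSuperconductivity.HubbardSuperconductivity.Theorems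

open Matrix Filter Literature.Probability.LatticeModels Literature.MathematicalPhysics.QuantumLattice
open scoped ComplexOrder Topology

/-- **Free gas: a ground state with small `d`-wave order in every sector.** At `U = 0`, `t = 1`,
side `n + 1 ≥ 3`: if the joint sector `(N, S^z = M)` of the fermionic torus has a ground state, it has
a unit ground state `ψ` with `re ⟨ψ, Δ_d†Δ_d ψ⟩ ≤ 32 · (n+1)²`. (Frame expansion of
`re tr (P_E Δ_d†Δ_d) ≤ 32 L² re tr P_E`, `P_E` the projection onto the sector ground eigenspace;
minimum ≤ average.) BCS (1957) §II; Yang (1962) §3. [folklore] -/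
theorem exists_groundState_dWave_order_le_free {n : ℕ} (hn : 3 ≤ n + 1) (N : ℕ) (M : ℝ)
    (hex : ∃ ψ, IsGroundStateInSector (hubbardTorus 2 (n + 1) 1 0) N M ψ) :
    ∃ ψ : Fock (Orb (FermionTorus 2 (n + 1))), star ψ ⬝ᵥ ψ = 1 ∧
      IsGroundStateInSector (hubbardTorus 2 (n + 1) 1 0) N M ψ ∧
      (expect ((pairField dWaveFormFactor (n + 1))ᴴ * pairField dWaveFormFactor (n + 1)) ψ).re ≤
        32 * ((n + 1 : ℕ) : ℝ) ^ 2 := by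
  set H := hubbardTorus 2 (n + 1) 1 0 with hH
  set e : ℂ := ((H.minEnergyOn (szSector N M) : ℝ) : ℂ) with he
  set E : Submodule ℂ (Finset (Orb (FermionTorus 2 (n + 1))) → ℂ) :=
    szSector (Λ := FermionTorus 2 (n + 1)) N M ⊓ Module.End.eigenspace (Matrix.toLin' H) e with hE
  set O := (pairField dWaveFormFactor (n + 1))ᴴ * pairField dWaveFormFactor (n + 1) with hO
  -- the Literature trace bound on the sector eigenprojection
  have htr : (projMatrix (E.map ((WithLp.linearEquiv 2 ℂ (Finset (Orb (FermionTorus 2 (n + 1))) → ℂ)).symm :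
      (Finset (Orb (FermionTorus 2 (n + 1))) → ℂ) →ₗ[ℂ]
        EuclideanSpace ℂ (Finset (Orb (FermionTorus 2 (n + 1)))))) * O).trace.re ≤
      32 * ((n + 1 : ℕ) : ℝ) ^ 2 *
      (projMatrix (E.map ((WithLp.linearEquiv 2 ℂ (Finset (Orb (FermionTorus 2 (n + 1))) → ℂ)).symm :
      (Finset (Orb (FermionTorus 2 (n + 1))) → ℂ) →ₗ[ℂ]
        EuclideanSpace ℂ (Finset (Orb (FermionTorus 2 (n + 1))))))).trace.re :=
    re_trace_sectorEigenProj_mul_pairField_dWave_le_free hn N M e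
  -- an orthonormal frame of `E`
  obtain ⟨k, b, hk, hbE, hb1, htrb⟩ := exists_frame_trace_projMatrix_map_mul E
  have hPtr := re_trace_projMatrix_map_eq_finrank E
  rw [htrb O, hPtr, ← hk, Complex.re_sum] at htr
  -- `E` is non-trivial: the given ground state lies in it
  obtain ⟨ψ₀, hψ₀S, hψ₀0, hψ₀H⟩ := hex
  have hψ₀E : ψ₀ ∈ E := by
    refine Submodule.mem_inf.2 ⟨hψ₀S, ?_⟩
    rw [Module.End.mem_eigenspace_iff, Matrix.toLin'_apply]
    exact hψ₀H
  have hkpos : 0 < k := by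
    rw [hk]
    exact Module.finrank_pos_iff_exists_ne_zero.2 ⟨⟨ψ₀, hψ₀E⟩, fun h => hψ₀0 (by
      simpa using congrArg Subtype.val h)⟩
  -- minimum ≤ average over the frame
  have hne : (Finset.univ : Finset (Fin k)).Nonempty :=
    Finset.univ_nonempty_iff.2 (Fin.pos_iff_nonempty.1 hkpos)
  have hsum : ∑ j : Fin k, (star (b j) ⬝ᵥ O *ᵥ b j).re ≤ ∑ _j : Fin k, 32 * ((n + 1 : ℕ) : ℝ) ^ 2 := by
    rw [Finset.sum_const, Finset.card_univ, Fintype.card_fin, nsmul_eq_mul]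
    linarith
  obtain ⟨j, -, hj⟩ := Finset.exists_le_of_sum_le hne hsum
  have hbj := Submodule.mem_inf.1 (hbE j)
  refine ⟨b j, hb1 j, ⟨hbj.1, ?_, ?_⟩, ?_⟩
  · intro h0
    have := hb1 j
    rw [h0, dotProduct_zero] at this
    exact zero_ne_one this
  · have h2 := hbj.2
    rw [Module.End.mem_eigenspace_iff, Matrix.toLin'_apply] at h2
    exact h2
  · simpa only [expect] using hj

/-- **The summit's conclusion fails for the free gas.** For every doping `δ ∈ (0, 1/2)` it is NOT
the case that every admissible sequence of unit sector ground states of the FREE torus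
`hubbardTorus 2 L 1 0` (sector `N = 2⌊(1-δ)L²/2⌋`, `S^z = 0`) has `d_{x²-y²}` pair-field
long-range order: the selection of `exists_groundState_dWave_order_le_free` at every side is
admissible and its box-averaged pair correlation at side `2k` is `≤ 32/(2k)²`. This is the matrix of
`HubbardSuperconductivity` with `U := 0`. BCS (1957) §II; Yang (1962) §3. [folklore] -/
theorem not_dWaveLRO_groundStates_free :
    ¬ ∃ δ ∈ Set.Ioo (0 : ℝ) (1 / 2), ∀ (N : ℕ → ℕ) (ψ : ∀ L, Fock (Orb (FermionTorus 2 L))),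
      (∀ L, Even L → N L = 2 * ⌊(1 - δ) * (L : ℝ) ^ 2 / 2⌋₊ ∧ star (ψ L) ⬝ᵥ ψ L = 1 ∧
        IsGroundStateInSector (hubbardTorus 2 L 1 0) (N L) 0 (ψ L)) →
      HasLongRangeOrder (fun k => halfOpenBox 2 (2 * k))
        (fun k => torusPullback (pairFieldCorr dWaveFormFactor ψ) (2 * k)) := by
  rintro ⟨δ, hδ, hS⟩
  have hgs0 : ∀ L : ℕ, ∃ φ : Fock (Orb (FermionTorus 2 L)), star φ ⬝ᵥ φ = 1 ∧
      IsGroundStateInSector (hubbardTorus 2 L 1 0) (2 * ⌊(1 - δ) * (L : ℝ) ^ 2 / 2⌋₊) 0 φ := by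
    intro L
    obtain ⟨φ₀, h1, hgs⟩ :=
      InfVolFermionState.exists_unit_isGroundStateInSector_rectN (1 : ℝ) 0 (n := 1 - δ)
        (by linarith [hδ.1]) L
    exact ⟨φ₀, h1, by simpa [ThermodynamicLimit.rectN] using hgs⟩
  -- at every positive side: a unit sector ground state, with order `≤ 32 (n+1)²` once `n + 1 ≥ 3`
  have hsel : ∀ n : ℕ, ∃ φ : Fock (Orb (FermionTorus 2 (n + 1))), star φ ⬝ᵥ φ = 1 ∧
      IsGroundStateInSector (hubbardTorus 2 (n + 1) 1 0) (2 * ⌊(1 - δ) * ((n + 1 : ℕ) : ℝ) ^ 2 / 2⌋₊) 0 φ ∧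
      (3 ≤ n + 1 → (expect ((pairField dWaveFormFactor (n + 1))ᴴ * pairField dWaveFormFactor (n + 1)) φ).re ≤
        32 * ((n + 1 : ℕ) : ℝ) ^ 2) := by
    intro n
    obtain ⟨φ₀, h1, hgs⟩ := hgs0 (n + 1)
    by_cases hn : 3 ≤ n + 1
    · obtain ⟨φ, hφ1, hφgs, hle⟩ := exists_groundState_dWave_order_le_free hn _ _ ⟨φ₀, hgs⟩
      exact ⟨φ, hφ1, hφgs, fun _ => hle⟩
    · exact ⟨φ₀, h1, hgs, fun h => absurd h hn⟩
  choose φsel hφ1 hφgs hφle using hsel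
  obtain ⟨φ₀, hφ₀⟩ := hgs0 0
  -- the admissible sequence
  let ψ : (L : ℕ) → Fock (Orb (FermionTorus 2 L)) := fun L =>
    match L with
    | 0 => φ₀
    | n + 1 => φsel n
  have hψadm : ∀ L, Even L → (fun L : ℕ => 2 * ⌊(1 - δ) * (L : ℝ) ^ 2 / 2⌋₊) L =
      2 * ⌊(1 - δ) * (L : ℝ) ^ 2 / 2⌋₊ ∧ star (ψ L) ⬝ᵥ ψ L = 1 ∧
      IsGroundStateInSector (hubbardTorus 2 L 1 0) ((fun L : ℕ => 2 * ⌊(1 - δ) * (L : ℝ) ^ 2 / 2⌋₊) L)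
        0 (ψ L) := by
    intro L _
    cases L with
    | zero => exact ⟨rfl, hφ₀.1, hφ₀.2⟩
    | succ n => exact ⟨rfl, hφ1 n, hφgs n⟩
  have hLRO := hS (fun L : ℕ => 2 * ⌊(1 - δ) * (L : ℝ) ^ 2 / 2⌋₊) ψ hψadm
  -- unfold the long-range order
  set u : ℕ → ℝ := fun L => (∑ x ∈ halfOpenBox 2 L, ∑ y ∈ halfOpenBox 2 L,
      torusPullback (pairFieldCorr dWaveFormFactor ψ) L x y) / ((halfOpenBox 2 L).card : ℝ) ^ 2 with hu
  change 0 < liminf (fun k : ℕ => u (2 * k)) atTop at hLRO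
  have hu_succ : ∀ n : ℕ, u (n + 1) =
      (expect ((pairField dWaveFormFactor (n + 1))ᴴ * pairField dWaveFormFactor (n + 1)) (φsel n)).re /
        ((n + 1 : ℕ) : ℝ) ^ 4 := by
    intro n
    simp only [hu]
    rw [sum_torusPullback_succ, sum_pairFieldCorr_succ]
  -- the selected sequence has `0 ≤ u (2k) ≤ 32 / k` for `k ≥ 2`
  have hu0 : ∀ k, 0 ≤ u (2 * k) := by
    intro k
    cases k with
    | zero =>
      have h0 : ((halfOpenBox 2 (2 * 0)).card : ℝ) ^ 2 = 0 := by rw [card_halfOpenBox]; simp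
      simp only [hu]
      rw [h0, div_zero]
    | succ k =>
      rw [show 2 * (k + 1) = (2 * k + 1) + 1 by ring, hu_succ]
      exact div_nonneg (re_expect_pairField_nonneg dWaveFormFactor _ _) (by positivity)
  have hule : ∀ k : ℕ, 2 ≤ k → u (2 * k) ≤ 32 / (k : ℝ) := by
    intro k hk
    obtain ⟨m, rfl⟩ : ∃ m, k = m + 1 := ⟨k - 1, by omega⟩
    rw [show 2 * (m + 1) = (2 * m + 1) + 1 by ring, hu_succ]
    have h3 : 3 ≤ 2 * m + 1 + 1 := by omega
    have hle := hφle (2 * m + 1) h3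
    set s : ℝ := (expect ((pairField dWaveFormFactor (2 * m + 1 + 1))ᴴ *
      pairField dWaveFormFactor (2 * m + 1 + 1)) (φsel (2 * m + 1))).re with hs
    have hx : ((2 * m + 1 + 1 : ℕ) : ℝ) = 2 * ((m + 1 : ℕ) : ℝ) := by push_cast; ring
    have h1 : (1 : ℝ) ≤ ((m + 1 : ℕ) : ℝ) := by exact_mod_cast Nat.succ_le_succ (Nat.zero_le m)
    rw [div_le_div_iff₀ (by positivity) (by positivity), hx]
    have hq : 0 < ((m + 1 : ℕ) : ℝ) := by positivity
    calc s * ((m + 1 : ℕ) : ℝ) ≤ 32 * (2 * ((m + 1 : ℕ) : ℝ)) ^ 2 * ((m + 1 : ℕ) : ℝ) := by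
          rw [← hx]; exact mul_le_mul_of_nonneg_right hle hq.le
      _ ≤ 32 * (2 * ((m + 1 : ℕ) : ℝ)) ^ 4 := by
          nlinarith [h1, pow_pos hq 2, pow_pos hq 3, mul_pos hq hq]
  -- hence `u (2k) → 0`, so the `liminf` is `0`: contradiction
  have hlim : Tendsto (fun k : ℕ => u (2 * k)) atTop (𝓝 0) := by
    have h32 : Tendsto (fun k : ℕ => (32 : ℝ) / (k : ℝ)) atTop (𝓝 0) :=
      tendsto_const_div_atTop_nhds_zero_nat 32
    refine tendsto_of_tendsto_of_tendsto_of_le_of_le' tendsto_const_nhds h32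
      (Eventually.of_forall hu0) ?_
    exact eventually_atTop.2 ⟨2, hule⟩
  rw [hlim.liminf_eq] at hLRO
  exact lt_irrefl 0 hLRO

end Summit.HubbardSuperconductivity.HubbardSuperconductivity.Theorems
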